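import Mathlib.FieldTheory.KrullTopology
import Mathlib.FieldTheory.IsAlgClosed.AlgebraicClosure
import Mathlib.FieldTheory.AbsoluteGaloisGroup
import Mathlib.FieldTheory.IntermediateField.Adjoin.Algebra
import Mathlib.RingTheory.EssentialFiniteness
import Mathlib.Topology.Algebra.ContinuousMonoidHom
import HarnessLib

/-!
# `Gal(L/K) ≤ Gal(L/F)` versus the absolute Galois group of an intermediate field `K`

Infinite Galois theory (Krull topology), textbook material: J. Neukirch, *Algebraic Number Theory*
(Springer 1999), Ch. IV §1 [cite: NeukirchANT1999, Ch. IV §1]; the statement needed by the abc-iut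
cell is [SemiAnbd] §6 p. 69, "`G_K := Gal(K̄/K)`" for a finite extension `K` of `ℚ_p` INSIDE a fixed
algebraic closure `K̄` of `ℚ_p` (S. Mochizuki, *Semi-graphs of anabelioids*, 2006): the closed
subgroup `Gal(K̄/K) = K.fixingSubgroup ≤ Gal(K̄/ℚ_p)` with the SUBSPACE topology "is" the absolute
Galois group of `K`.

For a tower `F ⊆ K ⊆ L` of fields (`K : IntermediateField F L`) and a `K`-algebra isomorphism
`e : L ≃ₐ[K] M`, Mathlib's abstract group isomorphism
`IntermediateField.fixingSubgroupEquiv K : K.fixingSubgroup ≃* (L ≃ₐ[K] L)` composed with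
conjugation by `e` gives `fixingSubgroupMulEquiv K e : K.fixingSubgroup ≃* (M ≃ₐ[K] M)`. We PROVE
that it is a homeomorphism for the Krull topologies — the subspace topology of `Gal(L/F)` on the
left, the Krull topology of `M/K` on the right — as soon as `L/F` is algebraic
(`continuous_fixingSubgroupMulEquiv`, `continuous_fixingSubgroupMulEquiv_symm`; NO finiteness of
`K/F` is needed: a `K`-finite subextension of `M` is generated by finitely many elements, each
algebraic over `F`, and conversely), and package it as
`fixingSubgroupContinuousMulEquiv K e : K.fixingSubgroup ≃ₜ* (M ≃ₐ[K] M)`.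

When `L` is algebraically closed (and algebraic over `F`) it is an algebraic closure of `K`
(`isAlgClosure_of_intermediateField`), so with Mathlib's `IsAlgClosure.equiv` we obtain
`fixingSubgroupEquivAbsoluteGaloisGroup K : K.fixingSubgroup ≃ₜ* Field.absoluteGaloisGroup K`
(canonical up to the choice of the `K`-isomorphism `L ≃ₐ[K] AlgebraicClosure K`, i.e. up to an
inner automorphism), and `nonempty_fixingSubgroup_continuousMulEquiv_absoluteGaloisGroup`.

Deliberately NOT here: functoriality in `K`, compatibility with restriction maps, and anything
specific to `ℚ_p` (the [SemiAnbd] specialisation `TemperedCurve.GK ≃ₜ* G_K` is a one-liner over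
this file, kept with the anabelian material).
-/

noncomputable section

open scoped Topology IntermediateField

namespace Literature.FieldTheory.Galois

universe u v w

variable {F : Type u} {L : Type v} [Field F] [Field L] [Algebra F L]
variable (K : IntermediateField F L) {M : Type w} [Field M] [Algebra K M]

/-- An automorphism over `B` fixing a set `t` pointwise fixes the intermediate field `B(t)`
pointwise. [folklore] -/
private theorem mem_fixingSubgroup_adjoin_iff {B N : Type*} [Field B] [Field N] [Algebra B N]
    (t : Set N) (ψ : N ≃ₐ[B] N) :
    ψ ∈ (IntermediateField.adjoin B t).fixingSubgroup ↔ ∀ x ∈ t, ψ x = x := by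
  rw [IntermediateField.mem_fixingSubgroup_iff]
  refine ⟨fun h x hx => h x (IntermediateField.subset_adjoin B t hx), fun h x hx => ?_⟩
  induction hx using IntermediateField.adjoin_induction with
  | mem x hx => exact h x hx
  | algebraMap c => exact ψ.commutes c
  | add x y _ _ hx hy => rw [map_add, hx, hy]
  | inv x _ hx => rw [map_inv₀, hx]
  | mul x y _ _ hx hy => rw [map_mul, hx, hy]

/-- A finite-dimensional intermediate field is finitely generated as an intermediate field
(Mathlib: `Module.Finite ⇒ Algebra.FiniteType ⇒ Algebra.EssFiniteType ⇔ FG`). [folklore] -/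
private theorem fg_of_finiteDimensional {B N : Type*} [Field B] [Field N] [Algebra B N]
    (E : IntermediateField B N) [FiniteDimensional B E] : E.FG :=
  IntermediateField.essFiniteType_iff.mp inferInstance

/-! ### The group isomorphism and its formulae -/

/-- **`Gal(L/K) ≃ Gal(M/K)`**: Mathlib's `IntermediateField.fixingSubgroupEquiv K :
K.fixingSubgroup ≃* (L ≃ₐ[K] L)` (the subgroup of `Gal(L/F)` fixing `K` pointwise IS `Gal(L/K)`)
followed by conjugation `AlgEquiv.autCongr e` along a `K`-isomorphism `e : L ≃ₐ[K] M`
(non-`Prop` plumbing; the content is in the continuity theorems below). [folklore] -/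
def fixingSubgroupMulEquiv (e : L ≃ₐ[K] M) : K.fixingSubgroup ≃* (M ≃ₐ[K] M) :=
  (IntermediateField.fixingSubgroupEquiv K).trans e.autCongr

/-- `fixingSubgroupMulEquiv K e σ = e ∘ σ ∘ e⁻¹`. [cite: NeukirchANT1999, Ch. IV §1] -/
theorem fixingSubgroupMulEquiv_apply (e : L ≃ₐ[K] M) (σ : K.fixingSubgroup) (y : M) :
    fixingSubgroupMulEquiv K e σ y = e ((σ : L ≃ₐ[F] L) (e.symm y)) := rfl

/-- `(fixingSubgroupMulEquiv K e)⁻¹ τ = e⁻¹ ∘ τ ∘ e` (as an automorphism of `L`).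
[cite: NeukirchANT1999, Ch. IV §1] -/
theorem fixingSubgroupMulEquiv_symm_apply (e : L ≃ₐ[K] M) (τ : M ≃ₐ[K] M) (x : L) :
    (((fixingSubgroupMulEquiv K e).symm τ : K.fixingSubgroup) : L ≃ₐ[F] L) x = e.symm (τ (e x)) :=
  rfl

/-! ### Continuity for the Krull topologies -/

/-- **Continuity of `Gal(L/K) → Gal(M/K)`** (subspace-of-Krull(`L/F`) to Krull(`M/K`)), for `L/F`
algebraic: a basic neighbourhood `Gal(M/E)` of `1`, `E/K` finite, `E = K(t)` with `t` finite, is hit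
by `Gal(L/F(e⁻¹ t)) ∩ Gal(L/K)`, and `F(e⁻¹ t)/F` is finite because `L/F` is algebraic.
[cite: NeukirchANT1999, Ch. IV §1] -/
theorem continuous_fixingSubgroupMulEquiv [Algebra.IsAlgebraic F L] (e : L ≃ₐ[K] M) :
    Continuous (fixingSubgroupMulEquiv K e) := by
  apply continuous_of_continuousAt_one _ (continuousAt_def.mpr _)
  intro s hs
  rw [map_one] at hs
  obtain ⟨E, hEfin, hEs⟩ := (krullTopology_mem_nhds_one_iff K M s).mp hs
  haveI := hEfin
  obtain ⟨t, ht⟩ := fg_of_finiteDimensional E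
  -- the `F`-finite subfield of `L` generated by `e⁻¹ t`
  set E₀ : IntermediateField F L :=
    IntermediateField.adjoin F ((fun y : M => e.symm y) '' (t : Set M)) with hE₀
  haveI : FiniteDimensional F E₀ :=
    IntermediateField.finiteDimensional_adjoin fun x _ => Algebra.IsIntegral.isIntegral x
  -- `{σ ∈ Gal(L/K) | σ ∈ Gal(L/E₀)}` is a neighbourhood of `1`
  have hU : ((↑) : K.fixingSubgroup → (L ≃ₐ[F] L)) ⁻¹' (E₀.fixingSubgroup : Set (L ≃ₐ[F] L)) ∈
      𝓝 (1 : K.fixingSubgroup) := by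
    refine (E₀.fixingSubgroup_isOpen.preimage continuous_subtype_val).mem_nhds ?_
    rw [Set.mem_preimage, SetLike.mem_coe, OneMemClass.coe_one]
    exact one_mem _
  refine Filter.mem_of_superset hU fun σ hσ => ?_
  rw [Set.mem_preimage, SetLike.mem_coe, IntermediateField.mem_fixingSubgroup_iff] at hσ
  rw [Set.mem_preimage]
  apply hEs
  rw [SetLike.mem_coe, ← ht, mem_fixingSubgroup_adjoin_iff]
  intro y hy
  rw [fixingSubgroupMulEquiv_apply,
    hσ _ (IntermediateField.subset_adjoin F _ ⟨y, hy, rfl⟩), AlgEquiv.apply_symm_apply]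

/-- **Continuity of `Gal(M/K) → Gal(L/K) ≤ Gal(L/F)`**, for `L/F` algebraic: a basic neighbourhood
`Gal(L/E₀) ∩ Gal(L/K)`, `E₀ = F(t₀)/F` finite, contains the image of `Gal(M/K(e t₀))`, and
`K(e t₀)/K` is finite. [cite: NeukirchANT1999, Ch. IV §1] -/
theorem continuous_fixingSubgroupMulEquiv_symm [Algebra.IsAlgebraic F L] (e : L ≃ₐ[K] M) :
    Continuous (fixingSubgroupMulEquiv K e).symm := by
  apply continuous_of_continuousAt_one _ (continuousAt_def.mpr _)
  intro s hs
  rw [map_one, nhds_subtype, Filter.mem_comap] at hs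
  obtain ⟨V, hV, hVs⟩ := hs
  rw [OneMemClass.coe_one] at hV
  obtain ⟨E₀, hE₀fin, hE₀V⟩ := (krullTopology_mem_nhds_one_iff F L V).mp hV
  haveI := hE₀fin
  obtain ⟨t₀, ht₀⟩ := fg_of_finiteDimensional E₀
  -- the `K`-finite subfield of `M` generated by `e t₀`
  set E : IntermediateField K M :=
    IntermediateField.adjoin K ((fun x : L => e x) '' (t₀ : Set L)) with hE
  haveI : Algebra.IsAlgebraic K L := IntermediateField.isAlgebraic_tower_top
  haveI : FiniteDimensional K E := by
    refine IntermediateField.finiteDimensional_adjoin fun y _ => ?_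
    have h := (Algebra.IsIntegral.isIntegral (R := K) (e.symm y)).map e
    rwa [AlgEquiv.apply_symm_apply] at h
  have hU : (E.fixingSubgroup : Set (M ≃ₐ[K] M)) ∈ 𝓝 (1 : M ≃ₐ[K] M) :=
    E.fixingSubgroup_isOpen.mem_nhds (one_mem _)
  refine Filter.mem_of_superset hU fun τ hτ => ?_
  rw [SetLike.mem_coe, IntermediateField.mem_fixingSubgroup_iff] at hτ
  rw [Set.mem_preimage]
  apply hVs
  rw [Set.mem_preimage]
  apply hE₀V
  rw [SetLike.mem_coe, ← ht₀, mem_fixingSubgroup_adjoin_iff]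
  intro x hx
  rw [fixingSubgroupMulEquiv_symm_apply,
    hτ _ (IntermediateField.subset_adjoin K _ ⟨x, hx, rfl⟩), AlgEquiv.symm_apply_apply]

/-- **`Gal(L/K) ≃ₜ* Gal(M/K)`** as an isomorphism of topological groups (Krull topologies; the
left-hand side carries the subspace topology of `Gal(L/F)`), for `L/F` algebraic and any
`K`-isomorphism `e : L ≃ₐ[K] M`. [cite: NeukirchANT1999, Ch. IV §1] -/
def fixingSubgroupContinuousMulEquiv [Algebra.IsAlgebraic F L] (e : L ≃ₐ[K] M) :
    K.fixingSubgroup ≃ₜ* (M ≃ₐ[K] M) where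
  toMulEquiv := fixingSubgroupMulEquiv K e
  continuous_toFun := continuous_fixingSubgroupMulEquiv K e
  continuous_invFun := continuous_fixingSubgroupMulEquiv_symm K e

/-- Underlying group isomorphism of `fixingSubgroupContinuousMulEquiv`.
[cite: NeukirchANT1999, Ch. IV §1] -/
theorem fixingSubgroupContinuousMulEquiv_toMulEquiv [Algebra.IsAlgebraic F L] (e : L ≃ₐ[K] M) :
    (fixingSubgroupContinuousMulEquiv K e).toMulEquiv = fixingSubgroupMulEquiv K e := rfl

/-! ### The absolute Galois group of an intermediate field of an algebraic closure -/

section AlgClosed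

variable [IsAlgClosed L] [Algebra.IsAlgebraic F L]

/-- An algebraically closed algebraic extension `L` of `F` is an algebraic closure of every
intermediate field `K`. [cite: NeukirchANT1999, Ch. IV §1] -/
theorem isAlgClosure_of_intermediateField : IsAlgClosure K L :=
  (isAlgClosure_iff K L).mpr ⟨inferInstance, IntermediateField.isAlgebraic_tower_top⟩

/-- A `K`-isomorphism of `L` with Mathlib's algebraic closure `AlgebraicClosure K` (a fixed choice,
Mathlib's `IsAlgClosure.equiv`; non-`Prop` plumbing). [folklore] -/
def algEquivAlgebraicClosure : L ≃ₐ[K] AlgebraicClosure K :=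
  haveI : IsAlgClosure K L := isAlgClosure_of_intermediateField K
  IsAlgClosure.equiv K L (AlgebraicClosure K)

/-- The identity `(K̄ ≃ₐ[K] K̄) ≃ₜ* Field.absoluteGaloisGroup K` through Mathlib's non-reducible
definition `Field.absoluteGaloisGroup K := AlgebraicClosure K ≃ₐ[K] AlgebraicClosure K` (the
derived topology IS the Krull topology; non-`Prop` plumbing). [folklore] -/
def algEquivContinuousMulEquivAbsoluteGaloisGroup (B : Type*) [Field B] :
    (AlgebraicClosure B ≃ₐ[B] AlgebraicClosure B) ≃ₜ* Field.absoluteGaloisGroup B where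
  toMulEquiv := MulEquiv.refl _
  continuous_toFun := continuous_id
  continuous_invFun := continuous_id

/-- **`Gal(L/K) ≃ₜ* G_K`**: for `F ⊆ K ⊆ L` with `L` algebraically closed and algebraic over `F`,
the closed subgroup `Gal(L/K) = K.fixingSubgroup` of `Gal(L/F)`, with the subspace topology, is
topologically isomorphic to the absolute Galois group `Gal(K̄/K)` of `K` ([SemiAnbd] §6 p. 69:
"`G_K := Gal(K̄/K)`" for `K ⊆ K̄` a finite extension of `ℚ_p`). Canonical up to the inner
automorphism coming from the choice `algEquivAlgebraicClosure K`.
[cite: NeukirchANT1999, Ch. IV §1] -/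
def fixingSubgroupEquivAbsoluteGaloisGroup : K.fixingSubgroup ≃ₜ* Field.absoluteGaloisGroup K :=
  (fixingSubgroupContinuousMulEquiv K (algEquivAlgebraicClosure K)).trans
    (algEquivContinuousMulEquivAbsoluteGaloisGroup K)

/-- Existence form of `fixingSubgroupEquivAbsoluteGaloisGroup` (for consumers that take the Galois
identification as a parameter). [cite: NeukirchANT1999, Ch. IV §1] -/
theorem nonempty_fixingSubgroup_continuousMulEquiv_absoluteGaloisGroup :
    Nonempty (K.fixingSubgroup ≃ₜ* Field.absoluteGaloisGroup K) :=
  ⟨fixingSubgroupEquivAbsoluteGaloisGroup K⟩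

end AlgClosed

end Literature.FieldTheory.Galois

end
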